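import Mathlib.Algebra.Group.Submonoid.Operations
import Mathlib.Algebra.Group.Pi.Lemmas
import Literature.IUT.HodgeArakelov.TemperedThetaMonoidsProofs
import Literature.IUT.HodgeArakelov.GaussianMonoidsGood
import Literature.IUT.HodgeArakelov.BadPrimeGaussianMonoidsProofs2

/-!
# [IUTchII] Cor 3.5 (ii)/(iii), Cor 3.6 (ii): the restriction isomorphism `Ψ_env ⥲ Ψ_gau` with restriction
# morphisms OUT OF THE THETA MONOID — REPAIR of `BadPrimeGaussianMonoidsProofs2` §3–§4 (finding d017-F1-1)

S. Mochizuki, *Inter-universal Teichmüller theory II*, kurims Dec-2020 manuscript, Cor 3.5 (ii)–(iii) pp. 94–95,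
Cor 3.6 (ii) p. 100 [cite: Mochizuki2012, Cor 3.5 (ii) p.94]. Claim key DISPUTED (D-0012). PROOF-ONLY (abc-iut cell,
layer L6, seat abc-iut-w4-d004; node IUTchII:Cor3.5(ii) restriction clause, IUTchII:Cor3.5(iii) splitting clause,
IUTchII:Cor3.6(ii)); NO definition, NO `Prop` fact.

WHY THIS FILE (RQ7 finding d017-F1-1, abc-iut-w4-d017, MEDIUM, upheld by the author): in
`BadPrimeGaussianMonoidsProofs2` §3–§4 the restriction morphisms were typed out of the ambient cohomology GROUP,
`r_t : H →* M`; a monoid morphism out of a group lands in the units of `M`, so the value-profile `(r_t θ)_t` was a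
family of UNITS — whereas in print the theta value `q_v^{t²}` is a NON-unit of `Ψ_cns ≅ O^▷_{F̄_v}` and
`Ψ_ξ := Ψ^×_cns,⟨F_l^⋇⟩ · ξ^ℕ` has unit factor `Ψ^×_cns = O^×`; consequently the surjectivity hypothesis `hUsurj` of
the ISOMORPHISM statements there is refuted by the intended model (the INCLUSION, injectivity-transfer, label
calculus and `Ψ_{2l·ξ}` statements of that file are unaffected). REPAIR (the finding's option (a)): the
restriction morphisms are typed OUT OF THE THETA MONOID, `r_t : Ψ^ι_env = M^×_TM · θ^ℕ →* M`, into the constant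
MONOID `M` (print: the copy `Ψ_cns(M^Θ_*)_{|t|} ≅ O^▷_{F̄_v}`, abc-iut-L6-t2's reading of `M` in
`BadPrimeGaussianMonoids.lean`), whose unit group `Mˣ` IS `Ψ^×_cns`; `θ ↦ ξ_t` may now be a non-unit, and the
hypotheses are satisfiable at the model (evaluation `u · Θ^n ↦ u · (q_v^{t²})^n`).

PROVED (same statements as before, correct junction typing):
* `mrange_pi_le_gaussianMonoid` / `mrange_pi_eq_gaussianMonoid` — the image of `M^×_TM · θ^ℕ` under
  `x ↦ (r_t x)_t` lies in / equals `Ψ_ξ = Ψ^×_{⟨F_l^⋇⟩} · ξ^ℕ`, `ξ_t := r_t θ`, when the units restrict to diagonal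
  unit families / and every diagonal unit family so arises (`Ψ^×_cns = M^×_TM`);
* `pi_injective_of_injective` — injectivity at ONE label suffices; `exists_restrictionIso'`,
  `restrictionIso'_unique` — "the lower horizontal arrow `Ψ^ι_env ⥲ Ψ_ξ` is an isomorphism of monoids", PINNED to
  the restriction map and unique as such; `exists_unique_restrictionIso'_thetaMonoid` for the typed `Ψ^ι_env` of
  abc-iut-L6-t2's `TemperedThetaMonoids.ThetaEnvData`;
* `image_units_eq_unitDiagonal` / `image_powers_theta` — Cor 3.5 (iii): the splitting factors `M^×_TM`, `θ^ℕ` go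
  ONTO the unit diagonal and `ξ^ℕ` ("compatible … with the splittings up to torsion of Proposition 3.1, (i)");
* `exists_kummerRestrictionTransportIso'` — Cor 3.6 (ii): the composite
  `Ψ_{†F^Θ_v,α} ⥲ Ψ^ι_env ⥲ Ψ_ξ ⥲ Ψ_{F_ξ}(†F_v)` from abc-iut-L6-t2's REAL `Prop33KummerStatements.kummerTheta`, pinned
  through the labeled Kummer copies `piIso`.
Nothing here asserts a disputed claim or takes a side on [IUTchIII] Cor 3.12; typed ≠ proved ≠ endorsed.
-/

namespace Literature.IUT.HodgeArakelov

namespace BadPrimeGaussianMonoids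

open TemperedThetaMonoids

universe u v w

/-! ### 1. The theta monoid `M^×_TM · θ^ℕ` as a domain -/

section Domain

variable {H : Type u} [CommGroup H] (U : Subgroup H) (θ : H)

/-- `u · θ^n ∈ M^×_TM · θ^ℕ`. [cite: Mochizuki2012, Prop 3.1 (i) p.87] -/
theorem mul_pow_mem_thetaSplit {u : H} (hu : u ∈ U) (n : ℕ) :
    u * θ ^ n ∈ splitMonoid U (Submonoid.powers θ) :=
  (mem_splitMonoid_iff _ _ _).mpr ⟨u, hu, θ ^ n, ⟨n, rfl⟩, rfl⟩

/-- `θ ∈ M^×_TM · θ^ℕ`. [cite: Mochizuki2012, Prop 3.1 (i) p.87] -/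
theorem theta_mem_thetaSplit : θ ∈ splitMonoid U (Submonoid.powers θ) :=
  Submonoid.mem_sup_right (Submonoid.mem_powers θ)

/-- `M^×_TM ⊆ M^×_TM · θ^ℕ`. [cite: Mochizuki2012, Prop 3.1 (i) p.87] -/
theorem mem_thetaSplit_of_mem_units {u : H} (hu : u ∈ U) : u ∈ splitMonoid U (Submonoid.powers θ) :=
  Submonoid.mem_sup_left hu

/-- Every element of `M^×_TM · θ^ℕ` is `u · θ^n` — as an identity IN the monoid.
[cite: Mochizuki2012, Prop 3.1 (i) p.87] -/
theorem exists_eq_unit_mul_theta_pow (x : splitMonoid U (Submonoid.powers θ)) :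
    ∃ (u : H) (hu : u ∈ U) (n : ℕ),
      x = ⟨u, mem_thetaSplit_of_mem_units U θ hu⟩ * ⟨θ, theta_mem_thetaSplit U θ⟩ ^ n := by
  obtain ⟨u, hu, _, ⟨n, rfl⟩, hx⟩ := (mem_splitMonoid_iff _ _ _).mp x.2
  exact ⟨u, hu, n, Subtype.ext (by simp [hx])⟩

end Domain

/-! ### 2. Cor 3.5 (ii): restriction morphisms out of `M^×_TM · θ^ℕ` into the constant monoid -/

section Restriction

variable {H : Type u} [CommGroup H] {T : Type v} {M : Type w} [CommMonoid M] (U : Subgroup H) (θ : H)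
  (r : T → (splitMonoid U (Submonoid.powers θ) →* M))

/-- **IUTchII:Cor3.5(ii)** (kurims p.94–95) restriction, inclusion: if the units `M^×_TM` restrict to DIAGONAL
unit families of the labeled constant monoids ("`Ψ_cns ⥲ Ψ_cns,⟨|F_l|⟩`", Cor 3.5 (i)), the product of the
restriction morphisms `r_t : Ψ^ι_env → Ψ_cns,|t|` carries `Ψ^ι_env = M^×_TM · θ^ℕ` into the Gaussian monoid
`Ψ_ξ = Ψ^×_{⟨F_l^⋇⟩} · ξ^ℕ` of the value-profile `ξ := (r_t θ)_t` (the theta values, non-units allowed).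
[cite: Mochizuki2012, Cor 3.5 (ii) p.94] -/
theorem mrange_pi_le_gaussianMonoid
    (hU : ∀ (u : H) (hu : u ∈ U), ∃ m : Mˣ, ∀ t, r t ⟨u, mem_thetaSplit_of_mem_units U θ hu⟩ = m) :
    MonoidHom.mrange (MonoidHom.pi r) ≤ gaussianMonoid (fun t => r t ⟨θ, theta_mem_thetaSplit U θ⟩) := by
  rintro _ ⟨x, rfl⟩
  obtain ⟨u, hu, n, rfl⟩ := exists_eq_unit_mul_theta_pow U θ x
  obtain ⟨m, hm⟩ := hU u hu
  rw [mem_gaussianMonoid_iff]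
  refine ⟨m, n, funext fun t => ?_⟩
  simp only [MonoidHom.pi_apply, map_mul, map_pow, Pi.mul_apply, Pi.pow_apply, hm t]

/-- **IUTchII:Cor3.5(ii)** (kurims p.94–95) restriction, image: if moreover every diagonal unit family is the
restriction of a unit of `M^×_TM` (in print `Ψ^×_cns = M^×_TM`), the image of `Ψ^ι_env` IS `Ψ_ξ`.
[cite: Mochizuki2012, Cor 3.5 (ii) p.94] -/
theorem mrange_pi_eq_gaussianMonoid
    (hU : ∀ (u : H) (hu : u ∈ U), ∃ m : Mˣ, ∀ t, r t ⟨u, mem_thetaSplit_of_mem_units U θ hu⟩ = m)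
    (hUsurj : ∀ m : Mˣ, ∃ (u : H) (hu : u ∈ U), ∀ t, r t ⟨u, mem_thetaSplit_of_mem_units U θ hu⟩ = m) :
    MonoidHom.mrange (MonoidHom.pi r) = gaussianMonoid (fun t => r t ⟨θ, theta_mem_thetaSplit U θ⟩) := by
  refine le_antisymm (mrange_pi_le_gaussianMonoid U θ r hU) ?_
  intro x hx
  obtain ⟨m, n, rfl⟩ := (mem_gaussianMonoid_iff _ _).mp hx
  obtain ⟨u, hu, hm⟩ := hUsurj m
  refine ⟨⟨u, mem_thetaSplit_of_mem_units U θ hu⟩ * ⟨θ, theta_mem_thetaSplit U θ⟩ ^ n, funext fun t => ?_⟩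
  simp only [MonoidHom.pi_apply, map_mul, map_pow, Pi.mul_apply, Pi.pow_apply, hm t]

/-- **IUTchII:Cor3.5(ii)** (kurims p.95) bookkeeping: the product of the restriction morphisms is injective on
`Ψ^ι_env` as soon as the restriction at ONE label is (in print: at a single evaluation point `u · Θ^n ↦ u · q_v^{t²n}`
already determines `u` and `n`, `q_v^{t²}` having positive valuation in `O^▷`). [cite: Mochizuki2012, Cor 3.5 (ii) p.95] -/
theorem pi_injective_of_injective (t₀ : T) (h : Function.Injective (r t₀)) :
    Function.Injective (MonoidHom.pi r) := fun x y hxy =>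
  h (by simpa only [MonoidHom.pi_apply] using congrFun hxy t₀)

/-- An injective monoid morphism is an isomorphism onto its range, pinned by its underlying map. [folklore] -/
private theorem exists_mulEquiv_mrange_of_injective {A : Type u} {B : Type v} [CommMonoid A] [CommMonoid B]
    (f : A →* B) (hf : Function.Injective f) :
    ∃ e : A ≃* MonoidHom.mrange f, ∀ x, ((e x : MonoidHom.mrange f) : B) = f x :=
  ⟨MulEquiv.ofBijective f.mrangeRestrict
    ⟨fun _ _ h => hf (congrArg Subtype.val h), f.mrangeRestrict_surjective⟩, fun _ => rfl⟩

/-- **IUTchII:Cor3.5(ii)** (kurims p.95) "the lower … horizontal arrow [`Ψ^ι_env(M^Θ_*) ⥲ Ψ_ξ(M^Θ_*)`] is an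
isomorphism of monoids": under the hypotheses of `mrange_pi_eq_gaussianMonoid` and injectivity at one label,
an isomorphism `M^×_TM · θ^ℕ ⥲ Ψ_ξ` whose underlying map IS the restriction `x ↦ (r_t x)_t`.
[cite: Mochizuki2012, Cor 3.5 (ii) p.95] -/
theorem exists_restrictionIso'
    (hU : ∀ (u : H) (hu : u ∈ U), ∃ m : Mˣ, ∀ t, r t ⟨u, mem_thetaSplit_of_mem_units U θ hu⟩ = m)
    (hUsurj : ∀ m : Mˣ, ∃ (u : H) (hu : u ∈ U), ∀ t, r t ⟨u, mem_thetaSplit_of_mem_units U θ hu⟩ = m)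
    (t₀ : T) (hinj : Function.Injective (r t₀)) :
    ∃ e : splitMonoid U (Submonoid.powers θ) ≃* gaussianMonoid (fun t => r t ⟨θ, theta_mem_thetaSplit U θ⟩),
      ∀ x, ((e x : gaussianMonoid _) : T → M) = MonoidHom.pi r x := by
  obtain ⟨e, he⟩ := exists_mulEquiv_mrange_of_injective (MonoidHom.pi r)
    (pi_injective_of_injective U θ r t₀ hinj)
  exact ⟨e.trans (MulEquiv.submonoidCongr (mrange_pi_eq_gaussianMonoid U θ r hU hUsurj)),
    fun x => by rw [MulEquiv.trans_apply, ← he x]; rfl⟩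

/-- **IUTchII:Cor3.5(ii)** (kurims p.95): the restriction isomorphism is UNIQUE among isomorphisms whose underlying
map is the restriction. [cite: Mochizuki2012, Cor 3.5 (ii) p.95] -/
theorem restrictionIso'_unique {ξ : T → M} (e e' : splitMonoid U (Submonoid.powers θ) ≃* gaussianMonoid ξ)
    (he : ∀ x, ((e x : gaussianMonoid ξ) : T → M) = MonoidHom.pi r x)
    (he' : ∀ x, ((e' x : gaussianMonoid ξ) : T → M) = MonoidHom.pi r x) : e = e' :=
  MulEquiv.ext fun x => Subtype.ext ((he x).trans (he' x).symm)

/-- **IUTchII:Cor3.5(iii)** (kurims p.95) "a splitting up to torsion … `Ψ_ξ = Ψ^×_cns,⟨F_l^⋇⟩ · ξ^ℕ` … compatible,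
relative to the restriction isomorphisms …, with the splittings up to torsion of Proposition 3.1, (i)" — unit
factor: restriction carries `M^×_TM` ONTO the unit diagonal. [cite: Mochizuki2012, Cor 3.5 (iii) p.95] -/
theorem image_units_eq_unitDiagonal
    (hU : ∀ (u : H) (hu : u ∈ U), ∃ m : Mˣ, ∀ t, r t ⟨u, mem_thetaSplit_of_mem_units U θ hu⟩ = m)
    (hUsurj : ∀ m : Mˣ, ∃ (u : H) (hu : u ∈ U), ∀ t, r t ⟨u, mem_thetaSplit_of_mem_units U θ hu⟩ = m) :
    MonoidHom.pi r '' {x | (x : H) ∈ U} = unitDiagonal T M := by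
  apply Set.Subset.antisymm
  · rintro _ ⟨x, hx, rfl⟩
    obtain ⟨m, hm⟩ := hU x hx
    exact ⟨m, funext fun t => by rw [MonoidHom.pi_apply, ← hm t]⟩
  · rintro _ ⟨m, rfl⟩
    obtain ⟨u, hu, hm⟩ := hUsurj m
    exact ⟨⟨u, mem_thetaSplit_of_mem_units U θ hu⟩, hu, funext fun t => by rw [MonoidHom.pi_apply, hm t]⟩

/-- **IUTchII:Cor3.5(iii)** (kurims p.95), theta factor: restriction carries `θ^ℕ` ONTO `ξ^ℕ`.
[cite: Mochizuki2012, Cor 3.5 (iii) p.95] -/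
theorem image_powers_theta :
    MonoidHom.pi r '' {x | (x : H) ∈ Submonoid.powers θ} =
      (Submonoid.powers (fun t => r t ⟨θ, theta_mem_thetaSplit U θ⟩) : Set (T → M)) := by
  have hξ : MonoidHom.pi r ⟨θ, theta_mem_thetaSplit U θ⟩ = fun t => r t ⟨θ, theta_mem_thetaSplit U θ⟩ :=
    funext fun t => MonoidHom.pi_apply _ _ _
  apply Set.Subset.antisymm
  · rintro _ ⟨x, hx, rfl⟩
    obtain ⟨n, hn⟩ := (Submonoid.mem_powers_iff _ _).mp hx
    have hx' : x = ⟨θ, theta_mem_thetaSplit U θ⟩ ^ n := Subtype.ext (by simp [← hn])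
    rw [SetLike.mem_coe, Submonoid.mem_powers_iff]
    exact ⟨n, by rw [hx', map_pow, hξ]⟩
  · rintro _ hx
    obtain ⟨n, rfl⟩ := (Submonoid.mem_powers_iff _ _).mp hx
    exact ⟨⟨θ, theta_mem_thetaSplit U θ⟩ ^ n, (Submonoid.mem_powers_iff _ _).mpr ⟨n, by simp⟩,
      by rw [map_pow, hξ]⟩

end Restriction

/-! ### 3. The same for the typed `Ψ^ι_env(M^Θ_*)` of Proposition 3.1, and the Cor 3.6 (ii) composite -/

section ThetaEnv

variable {P : Type u} [Group P] (E : TemperedThetaMonoids.ThetaEnvData.{u, v} P) {T : Type w} {M : Type*}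
  [CommMonoid M]

/-- **IUTchII:Cor3.5(ii)** (kurims p.95) for the typed `Ψ^ι_env(M^Θ_*)` (one `M^×_TM`-orbit `θ^ι_env`, so that
`Ψ^ι_env = M^×_TM · θ^ℕ`, `thetaMonoid_eq_splitMonoid_powers` of Proofs2): for restriction morphisms
`r_t : Ψ^ι_env(M^Θ_*) → Ψ_cns(M^Θ_*)_{|t|}` OUT OF THE THETA MONOID, a UNIQUE isomorphism `Ψ^ι_env ⥲ Ψ_ξ`,
`ξ = (r_t θ)_t`, whose underlying map is the restriction (hypotheses: diagonal units, `Ψ^×_cns = M^×_TM`,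
injectivity at one label). [cite: Mochizuki2012, Cor 3.5 (ii) p.95] -/
theorem exists_unique_restrictionIso'_thetaMonoid {ι : E.Iota} {θ : E.H} (hθ : θ ∈ E.thetaEnv ι)
    (horb : ∀ θ' ∈ E.thetaEnv ι, ∃ u ∈ E.units, θ' = u * θ) (r : T → (E.thetaMonoid ι →* M))
    (hU : ∀ (u : E.H) (hu : u ∈ E.units), ∃ m : Mˣ, ∀ t, r t ⟨u, units_le_thetaMonoid E ι hu⟩ = m)
    (hUsurj : ∀ m : Mˣ, ∃ (u : E.H) (hu : u ∈ E.units), ∀ t, r t ⟨u, units_le_thetaMonoid E ι hu⟩ = m)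
    (t₀ : T) (hinj : Function.Injective (r t₀)) :
    ∃! e : E.thetaMonoid ι ≃* gaussianMonoid (fun t => r t ⟨θ, thetaEnv_subset_thetaMonoid E ι hθ⟩),
      ∀ x, ((e x : gaussianMonoid _) : T → M) = MonoidHom.pi r x := by
  have hS := thetaMonoid_eq_splitMonoid_powers E hθ horb
  let c : splitMonoid E.units (Submonoid.powers θ) ≃* E.thetaMonoid ι := MulEquiv.submonoidCongr hS.symm
  let r' : T → (splitMonoid E.units (Submonoid.powers θ) →* M) := fun t => (r t).comp c.toMonoidHom
  obtain ⟨e, he⟩ := exists_restrictionIso' E.units θ r' (fun u hu => hU u hu) (fun m => hUsurj m) t₀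
    (hinj.comp c.injective)
  have he₂ : ∀ x : E.thetaMonoid ι,
      (((c.symm.trans e) x : gaussianMonoid _) : T → M) = MonoidHom.pi r x := fun x =>
    (he (c.symm x)).trans (funext fun t => by
      rw [MonoidHom.pi_apply, MonoidHom.pi_apply]
      exact congrArg (r t) (c.apply_symm_apply x))
  exact ⟨c.symm.trans e, he₂, fun e' he' =>
    MulEquiv.ext fun x => Subtype.ext ((he' x).trans (he₂ x).symm)⟩

end ThetaEnv

section KummerDiagram

variable {P : Type u} [Group P] {E : TemperedThetaMonoids.ThetaEnvData.{u, v} P}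
  {F : TemperedFrobenioidThetaData.{u, v} P} (K : Prop33KummerStatements E F)
  {T : Type w} {M : Type*} [CommMonoid M] {N : Type*} [CommMonoid N]

/-- **IUTchII:Cor3.6(ii)** (kurims p.100) "by composing the Kummer isomorphisms … of Proposition 3.3, (i), (ii),
with the restriction isomorphisms of Corollary 3.5, (ii), one obtains … `Ψ_{†F^Θ_v,α} ⥲ Ψ^ι_env(M^Θ_*) ⥲
Ψ_ξ(M^Θ_*) ⥲ Ψ_{F_ξ}(†F_v)` … isomorphisms of monoids": from abc-iut-L6-t2's REAL `kummerTheta α` and a restriction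
isomorphism OUT OF THE THETA MONOID whose underlying map is the restriction (`exists_unique_restrictionIso'_thetaMonoid`),
the COMPOSITE `Ψ_{†F^Θ_v,α} ⥲ Ψ_{F_ξ}(†F_v)` exists, pinned: read through the labeled Kummer copies `piIso T e` it IS
"restriction ∘ Kummer". [cite: Mochizuki2012, Cor 3.6 (ii) p.100] -/
theorem exists_kummerRestrictionTransportIso' (α : P) (r : T → (E.thetaMonoid (K.label α) →* M))
    {ξ : T → M} (eΨ : E.thetaMonoid (K.label α) ≃* gaussianMonoid ξ)
    (heΨ : ∀ y, ((eΨ y : gaussianMonoid ξ) : T → M) = MonoidHom.pi r y) (e : N ≃* M) :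
    ∃ Φ : F.frobThetaMonoid α ≃* frobenioidGaussianMonoid e ξ,
      ∀ x, piIso T e ((Φ x : frobenioidGaussianMonoid e ξ) : T → N) = MonoidHom.pi r (K.kummerTheta α x) := by
  have hmap : (frobenioidGaussianMonoid e ξ).map (piIso T e : (T → N) →* (T → M)) = gaussianMonoid ξ := by
    rw [frobenioidGaussianMonoid, MulEquiv.toMonoidHom_eq_coe, Submonoid.map_comap_eq_of_surjective]
    exact (piIso T e).surjective
  let ψ : frobenioidGaussianMonoid e ξ ≃* gaussianMonoid ξ :=
    ((piIso T e).submonoidMap (frobenioidGaussianMonoid e ξ)).trans (MulEquiv.submonoidCongr hmap)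
  have hψ : ∀ x, ((ψ x : gaussianMonoid ξ) : T → M) = piIso T e x := fun x => rfl
  refine ⟨(K.kummerTheta α).trans (eΨ.trans ψ.symm), fun x => ?_⟩
  rw [MulEquiv.trans_apply, MulEquiv.trans_apply, ← hψ, MulEquiv.apply_symm_apply, heΨ]

end KummerDiagram

end BadPrimeGaussianMonoids

end Literature.IUT.HodgeArakelov
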